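import Mathlib.GroupTheory.Index
import Mathlib.Data.ZMod.Basic
import HarnessLib

/-!
# Route `AlignedTransportAtTwo`, crux C1 `MainConjectureTransportAlignedAtTwo` (stmt-BirchSwinnertonDyer-22296), line `birth`:
# the ALGEBRAIC CORE of the `Δ > 0` trichotomy — mod-`2` functionals through a quotient of order `≤ 4`

Cell `bsd-f1-sign2`, WIDTH-5 attach seat `bsd-line-att-p4` g11 (`--supports stmt-BirchSwinnertonDyer-22296`). THEOREMS ONLY (pure additive
group theory; no `def`, no named fact, no `sorry`). BSD is not proved by this; C1 is not closed by this.

On the `Δ < 0` locus the lead's (K2) step (`…BuzzardKTwo.kTwo_of_dvd_S3`) has the shape «for every additive `K ⊇ (relations)`, `x ∉ K`,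
`y ∉ K ⇒ x − y ∈ K`» (index `≤ 2`: complex conjugation is a transvection on `Λ/𝔪Λ`), whence two non-zero mod-`2` plus functionals killing `K`
coincide. On `{Δ > 0, OFF the Kilford stratum}` Buzzard still gives `dim Λ/𝔪Λ = 2`, i.e. INDEX `≤ 4`, and conjugation is trivial; the
replacement for (K2) is then the following elementary statement (crux workfile `DELTA-POS-RESIDUAL-att-p4-g11.md` §5): if `f, g : A → ℤ/2` are
additive, kill `K`, are non-zero and distinct, and `[A : K] ≤ 4`, then EVERY additive `h : A → ℤ/2` killing `K` is one of `0, f, g, f + g`.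
Applied to `f = φ̄⁺₁`, `g = φ̄⁻₁` (the even- and odd-branch functionals of `W₁`) and `h = φ̄⁺₂`: «`λ⁺`-law ∨ cross-law ∨ sum-law» on that locus.

* `surjective_prod_of_ne` — `a ↦ (f a, g a)` is onto `(ℤ/2)²` when `f, g ≠ 0`, `f ≠ g`;
* `ker_prod_eq_of_index_le_four` — then `K = ker f ⊓ ker g` as soon as `K ≤ ker f ⊓ ker g` and `[A : K] ≤ 4` (indices);
* `eq_zero_or_eq_or_eq_or_eq_add` — THE TRICHOTOMY (tetrachotomy with `0`) for any `h` killing `K`.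

References: elementary; the use is Buzzard 2000 Prop. 2.4 [Buzzard2000LevelLoweringModTwo] on the `Δ > 0` locus.
-/

set_option autoImplicit false
-- justification: the `Summit.BirchSwinnertonDyer.BirchSwinnertonDyer.…` path repeats a component (route-file convention)
set_option linter.dupNamespace false

namespace Summit.BirchSwinnertonDyer.BirchSwinnertonDyer.Theorems.AlignedTransportAtTwoTrichotomyAlgebra

variable {A : Type*} [AddCommGroup A]

/-- **`a ↦ (f a, g a)` is onto `(ℤ/2)²`** for additive `f, g : A → ℤ/2` with `f ≠ 0`, `g ≠ 0`, `f ≠ g`: the image is a subgroup containing an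
element with first coordinate `1`, one with second coordinate `1`, and one with distinct coordinates. [folklore] -/
theorem surjective_prod_of_ne (f g : A →+ ZMod 2) (hf : f ≠ 0) (hg : g ≠ 0) (hfg : f ≠ g) :
    Function.Surjective (f.prod g) := by
  -- every element of `ℤ/2` is `0` or `1` (inline; the tree's `KramerTwoDescent.zmod_two_cases`, not imported into this pure-algebra file)
  have zmod_two_eq_zero_or_one : ∀ x : ZMod 2, x = 0 ∨ x = 1 := by decide
  -- witnesses
  obtain ⟨a, ha⟩ : ∃ a, f a = 1 := by
    by_contra! h
    exact hf (AddMonoidHom.ext fun x ↦ (zmod_two_eq_zero_or_one (f x)).resolve_right (h x))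
  obtain ⟨b, hb⟩ : ∃ b, g b = 1 := by
    by_contra! h
    exact hg (AddMonoidHom.ext fun x ↦ (zmod_two_eq_zero_or_one (g x)).resolve_right (h x))
  obtain ⟨c, hc⟩ : ∃ c, f c ≠ g c := by
    by_contra! h
    exact hfg (AddMonoidHom.ext h)
  -- an element `u` with `(f u, g u) = (1, 0)` and an element `v` with `(f v, g v) = (0, 1)`
  have key : ∃ u v : A, (f u = 1 ∧ g u = 0) ∧ (f v = 0 ∧ g v = 1) := by
    rcases zmod_two_eq_zero_or_one (f c) with hfc | hfc <;> rcases zmod_two_eq_zero_or_one (g c) with hgc | hgc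
    · exact absurd (hfc.trans hgc.symm) hc
    · -- `(f c, g c) = (0, 1)`; `u := a` or `a + c`
      rcases zmod_two_eq_zero_or_one (g a) with hga | hga
      · exact ⟨a, c, ⟨ha, hga⟩, ⟨hfc, hgc⟩⟩
      · refine ⟨a + c, c, ⟨?_, ?_⟩, ⟨hfc, hgc⟩⟩
        · rw [map_add, ha, hfc, add_zero]
        · rw [map_add, hga, hgc]; decide
    · -- `(f c, g c) = (1, 0)`; `v := b` or `b + c`
      rcases zmod_two_eq_zero_or_one (f b) with hfb | hfb
      · exact ⟨c, b, ⟨hfc, hgc⟩, ⟨hfb, hb⟩⟩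
      · refine ⟨c, b + c, ⟨hfc, hgc⟩, ⟨?_, ?_⟩⟩
        · rw [map_add, hfb, hfc]; decide
        · rw [map_add, hb, hgc, add_zero]
    · exact absurd (hfc.trans hgc.symm) hc
  obtain ⟨u, v, ⟨hfu, hgu⟩, ⟨hfv, hgv⟩⟩ := key
  rintro ⟨x, y⟩
  refine ⟨x.val • u + y.val • v, ?_⟩
  rw [AddMonoidHom.prod_apply, map_add, map_add, map_nsmul, map_nsmul, map_nsmul, map_nsmul, hfu, hgu, hfv, hgv]
  ext <;> simp

/-- **Index bookkeeping**: if `K ≤ ker f ⊓ ker g`, `[A : K] ≤ 4` (finite index) and `a ↦ (f a, g a)` is onto `(ℤ/2)²`, then `K = ker (f, g)`.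
[folklore] -/
theorem ker_prod_eq_of_index_le_four (K : AddSubgroup A) (f g : A →+ ZMod 2) (hK : K ≤ (f.prod g).ker)
    (hfin : K.index ≠ 0) (hle : K.index ≤ 4) (hsurj : Function.Surjective (f.prod g)) : (f.prod g).ker = K := by
  -- `[A : ker (f,g)] = 4`
  have h4 : (f.prod g).ker.index = 4 := by
    rw [AddSubgroup.index_ker, AddMonoidHom.range_eq_top.mpr hsurj, AddSubgroup.card_top, Nat.card_prod, Nat.card_zmod]
  -- `[A : K] = [ker : K]·[A : ker]`
  have hmul := AddSubgroup.relIndex_mul_index hK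
  rw [h4] at hmul
  have hrel : K.relIndex (f.prod g).ker = 1 := by
    have h1 : K.relIndex (f.prod g).ker * 4 ≤ 4 := hmul ▸ hle
    have h2 : K.relIndex (f.prod g).ker ≠ 0 := fun h0 ↦ hfin (by rw [← hmul, h0, zero_mul])
    omega
  exact le_antisymm (AddSubgroup.relIndex_eq_one.mp hrel) hK

/-- **THE TRICHOTOMY (with `0`: four cases).** `A` an additive group, `K ≤ A` of finite index `≤ 4`; `f, g : A →+ ℤ/2` killing `K`, non-zero
and distinct. Then every additive `h : A →+ ℤ/2` killing `K` is `0`, `f`, `g` or `f + g`. (The dual of `A/K ≅ (ℤ/2)²` has four elements.)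
Intended use: `A = Λ` the period homology, `K ⊇ 2Λ + 𝔪Λ` (Buzzard: `[Λ : 𝔪Λ] = 4` off the Kilford stratum), `f, g` the two branch
functionals of `W₁`, `h` a branch functional of `W₂`, on the `Δ > 0` locus where conjugation gives no further relation. [folklore] -/
theorem eq_zero_or_eq_or_eq_or_eq_add (K : AddSubgroup A) (hfin : K.index ≠ 0) (hle : K.index ≤ 4)
    (f g h : A →+ ZMod 2) (hf : K ≤ f.ker) (hg : K ≤ g.ker) (hh : K ≤ h.ker)
    (hf0 : f ≠ 0) (hg0 : g ≠ 0) (hfg : f ≠ g) :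
    h = 0 ∨ h = f ∨ h = g ∨ h = f + g := by
  have zmod_two_eq_zero_or_one : ∀ x : ZMod 2, x = 0 ∨ x = 1 := by decide
  have hsurj := surjective_prod_of_ne f g hf0 hg0 hfg
  have hKle : K ≤ (f.prod g).ker := fun a ha ↦ by
    rw [AddMonoidHom.mem_ker, AddMonoidHom.prod_apply, Prod.mk_eq_zero]
    exact ⟨(AddMonoidHom.mem_ker).mp (hf ha), (AddMonoidHom.mem_ker).mp (hg ha)⟩
  have hker := ker_prod_eq_of_index_le_four K f g hKle hfin hle hsurj
  -- generators `u ↦ (1,0)`, `v ↦ (0,1)`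
  obtain ⟨u, hu⟩ := hsurj (1, 0)
  obtain ⟨v, hv⟩ := hsurj (0, 1)
  rw [AddMonoidHom.prod_apply, Prod.mk.injEq] at hu hv
  -- `h a = (f a)·h u + (g a)·h v` for every `a`
  have hdec : ∀ a : A, h a = (f a).val • h u + (g a).val • h v := by
    intro a
    have hmem : a - ((f a).val • u + (g a).val • v) ∈ K := by
      rw [← hker, AddMonoidHom.mem_ker, AddMonoidHom.prod_apply, Prod.mk_eq_zero, map_sub, map_sub, map_add, map_add,
        map_nsmul, map_nsmul, map_nsmul, map_nsmul, hu.1, hu.2, hv.1, hv.2]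
      constructor <;> simp
    have h0 : h (a - ((f a).val • u + (g a).val • v)) = 0 := (AddMonoidHom.mem_ker).mp (hh hmem)
    rw [map_sub, sub_eq_zero, map_add, map_nsmul, map_nsmul] at h0
    exact h0
  -- four cases on `(h u, h v)`
  rcases zmod_two_eq_zero_or_one (h u) with hu0 | hu1 <;> rcases zmod_two_eq_zero_or_one (h v) with hv0 | hv1
  · refine Or.inl (AddMonoidHom.ext fun a ↦ ?_)
    rw [hdec a, hu0, hv0, smul_zero, smul_zero, add_zero, AddMonoidHom.zero_apply]
  · refine Or.inr (Or.inr (Or.inl (AddMonoidHom.ext fun a ↦ ?_)))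
    rw [hdec a, hu0, hv1, smul_zero, zero_add]
    simp
  · refine Or.inr (Or.inl (AddMonoidHom.ext fun a ↦ ?_))
    rw [hdec a, hu1, hv0, smul_zero, add_zero]
    simp
  · refine Or.inr (Or.inr (Or.inr (AddMonoidHom.ext fun a ↦ ?_)))
    rw [hdec a, hu1, hv1, AddMonoidHom.add_apply]
    simp

/-- **Trichotomy for a NON-ZERO `h`**: under the same hypotheses with `h ≠ 0`, `h = f ∨ h = g ∨ h = f + g`. [folklore] -/
theorem eq_or_eq_or_eq_add_of_ne_zero (K : AddSubgroup A) (hfin : K.index ≠ 0) (hle : K.index ≤ 4)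
    (f g h : A →+ ZMod 2) (hf : K ≤ f.ker) (hg : K ≤ g.ker) (hh : K ≤ h.ker)
    (hf0 : f ≠ 0) (hg0 : g ≠ 0) (hfg : f ≠ g) (hh0 : h ≠ 0) :
    h = f ∨ h = g ∨ h = f + g := by
  rcases eq_zero_or_eq_or_eq_or_eq_add K hfin hle f g h hf hg hh hf0 hg0 hfg with h0 | h1
  · exact absurd h0 hh0
  · exact h1

end Summit.BirchSwinnertonDyer.BirchSwinnertonDyer.Theorems.AlignedTransportAtTwoTrichotomyAlgebra
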